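import Summits.QuantumFields.YangMills.Theorems.BalabanLadderNTLinkEquipartition
import HarnessLib

/-!
# Crux `NT` (stmt-QuantumFields-19353): the REFINED PINCH of the one-link cost and two abstract integral bounds
# (tools of the one-link variance floor)

Fleet lead prover of crux `NT` (unit `ym-spine-19353-p1`, g30).  Sequel of `Theorems/BalabanLadderNTLinkEquipartitionDefs`
(Frobenius bookkeeping, `linkCost`).  For a group `G` with a unitary representation `ρ : G →* M_N(ℂ)` and a finite staple family
`k : ι → G` with one-link cost `u_k(h) = Σ_i (N − Re tr ρ(h k_i)) = ½ Σ_i ‖ρ h − ρ(k_i⁻¹)‖_F²`: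

* §1 **the refined pinch around ANY base point `g₀`** (tree `sum_normSq_sub_sub_sum_normSq_sub` + the Frobenius Cauchy–Schwarz
  `|⟨X, Y⟩| ≤ ‖X‖ ‖Y‖`, `abs_reIP_le_norm_mul_norm`):
  `u_k(h) − u_k(g₀) = (m/2) r² + ⟨ρ h − ρ g₀, Σ_i (ρ g₀ − ρ(k_i⁻¹))⟩` (`linkCost_sub_linkCost_eq`), `r = ‖ρ h − ρ g₀‖_F`, `m = #ι`,
  hence `|u_k(h) − u_k(g₀) − (m/2) r²| ≤ m · r · √(2 u_k(g₀))` (`abs_linkCost_sub_sub_le`) and, when the staples are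
  `θ/β`-CONSISTENT as seen from `g₀` (`u_k(g₀) ≤ θ/β`), the quadratic pinch with `O(1/β)` slack at the Gaussian scale
  `r ≍ β^{−1/2}` (`linkCost_pinch_of_consistent`) — no minimiser, no criticality, no chart;
* §2 two abstract integral bounds on a finite measure space: **two masses give a variance**
  (`sq_mul_min_le_integral_sq_sub_mul`: `f ≤ L₁` on `R₁`, `f ≥ L₂ ≥ L₁ + 2q` on `R₂`, weight `≥ w_j` on `R_j` ⇒
  `q² min(w₁ μR₁, w₂ μR₂) ≤ ∫ (f − c)² w` for EVERY `c`) and the **near/far split of a normaliser**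
  (`integral_le_near_add_far`: `w ≤ B` on `Rn`, `w ≤ l·u·w` off `Rn` ⇒ `∫ w ≤ B μ(Rn) + l ∫ u w`).

The sequel `Theorems/BalabanLadderNTLinkVarianceFloor` assembles them with g9's two-sided small-ball bounds into the one-link
VARIANCE FLOOR.  HONEST FRAMING: elementary matrix algebra and measure theory; nothing about NT, the seam or the gap; not Clay.
Refs: Horn–Johnson 2013 Thm. 5.6.2 (Frobenius); Montvay–Münster 1994 §3.2.
-/

set_option autoImplicit false

noncomputable section

open scoped Matrix Matrix.Norms.Frobenius ENNReal NNReal Topology BigOperators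
open MeasureTheory Measure Filter Set Metric
open Literature.MathematicalPhysics.QuantumLattice Literature.MathematicalPhysics.QuantumFieldTheory
open Summit.QuantumFields.YangMills.Theorems.FreeEnergyLogCoefficient

namespace Summit.QuantumFields.YangMills.Cruxes.NT.LinkEquipartition

/-! ## §1 Frobenius Cauchy–Schwarz and the refined pinch of the one-link cost -/

section Pinch

variable {N : ℕ}

/-- **Cauchy–Schwarz for the real Hilbert–Schmidt pairing**: `|⟨X, Y⟩| ≤ ‖X‖_F ‖Y‖_F`. [folklore] -/
theorem abs_reIP_le_norm_mul_norm (X Y : Matrix (Fin N) (Fin N) ℂ) : |reIP X Y| ≤ ‖X‖ * ‖Y‖ := by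
  by_cases hX : ‖X‖ = 0
  · have hX0 : X = 0 := norm_eq_zero.1 hX
    subst hX0
    simp [reIP]
  by_cases hY : ‖Y‖ = 0
  · have hY0 : Y = 0 := norm_eq_zero.1 hY
    subst hY0
    simp [reIP]
  have hXpos : 0 < ‖X‖ := lt_of_le_of_ne (norm_nonneg _) (Ne.symm hX)
  have hYpos : 0 < ‖Y‖ := lt_of_le_of_ne (norm_nonneg _) (Ne.symm hY)
  have h := two_mul_abs_reIP_le X Y (s := ‖Y‖ / ‖X‖) (by positivity)
  have e : ‖Y‖ / ‖X‖ * ‖X‖ ^ 2 + (‖Y‖ / ‖X‖)⁻¹ * ‖Y‖ ^ 2 = 2 * (‖X‖ * ‖Y‖) := by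
    field_simp
    ring
  linarith

variable {G : Type*} [Group G] (ρ : G →* Matrix (Fin N) (Fin N) ℂ)

/-- **The refined pinch (exact form)**: `u_k(h) − u_k(g₀) = (m/2) ‖ρ h − ρ g₀‖² + ⟨ρ h − ρ g₀, Σ_i (ρ g₀ − ρ(k_i⁻¹))⟩` for EVERY base
point `g₀` (the staples enter only through their total "inconsistency vector" seen from `g₀`). [folklore] -/
theorem linkCost_sub_linkCost_eq (hU : ∀ g, ρ g ∈ Matrix.unitaryGroup (Fin N) ℂ) {ι : Type*} [Fintype ι]
    (k : ι → G) (g₀ h : G) :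
    linkCost ρ k h - linkCost ρ k g₀ =
      (Fintype.card ι : ℝ) / 2 * ‖ρ h - ρ g₀‖ ^ 2 + reIP (ρ h - ρ g₀) (∑ i, (ρ g₀ - ρ (k i)⁻¹)) := by
  have hid := sum_normSq_sub_sub_sum_normSq_sub (ρ h) (ρ g₀) (fun i => ρ (k i)⁻¹)
  rw [linkCost_eq_half_sum_normSq ρ hU, linkCost_eq_half_sum_normSq ρ hU]
  linarith

/-- Each plaquette cost through the link is at most the one-link cost (the terms are non-negative). [folklore] -/
theorem sub_re_trace_le_linkCost (hU : ∀ g, ρ g ∈ Matrix.unitaryGroup (Fin N) ℂ) {ι : Type*} [Fintype ι]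
    (k : ι → G) (h : G) (i : ι) : (N : ℝ) - (ρ (h * k i)).trace.re ≤ linkCost ρ k h := by
  unfold linkCost
  refine Finset.single_le_sum (f := fun j => (N : ℝ) - (ρ (h * k j)).trace.re) (fun j _ => ?_) (Finset.mem_univ i)
  have h2 := normSq_map_sub_map_inv ρ hU h (k j)
  nlinarith [sq_nonneg ‖ρ h - ρ (k j)⁻¹‖]

/-- **The refined pinch (bound)**: `|u_k(h) − u_k(g₀) − (m/2) r²| ≤ m · r · √(2 u_k(g₀))`, `r = ‖ρ h − ρ g₀‖_F`, `m = #ι` —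
consistency of the staples as seen from `g₀` (`u_k(g₀)` small) makes the cost a clean quadratic in the chord `r`. [folklore] -/
theorem abs_linkCost_sub_sub_le (hU : ∀ g, ρ g ∈ Matrix.unitaryGroup (Fin N) ℂ) {ι : Type*} [Fintype ι]
    (k : ι → G) (g₀ h : G) :
    |linkCost ρ k h - linkCost ρ k g₀ - (Fintype.card ι : ℝ) / 2 * ‖ρ h - ρ g₀‖ ^ 2| ≤
      Fintype.card ι * ‖ρ h - ρ g₀‖ * Real.sqrt (2 * linkCost ρ k g₀) := by
  rw [linkCost_sub_linkCost_eq ρ hU k g₀ h, add_sub_cancel_left]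
  have hterm : ∀ i, ‖ρ g₀ - ρ (k i)⁻¹‖ ≤ Real.sqrt (2 * linkCost ρ k g₀) := by
    intro i
    rw [← Real.sqrt_sq (norm_nonneg (ρ g₀ - ρ (k i)⁻¹)), normSq_map_sub_map_inv ρ hU]
    exact Real.sqrt_le_sqrt (by linarith [sub_re_trace_le_linkCost ρ hU k g₀ i])
  calc |reIP (ρ h - ρ g₀) (∑ i, (ρ g₀ - ρ (k i)⁻¹))|
      ≤ ‖ρ h - ρ g₀‖ * ‖∑ i, (ρ g₀ - ρ (k i)⁻¹)‖ := abs_reIP_le_norm_mul_norm _ _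
    _ ≤ ‖ρ h - ρ g₀‖ * ∑ i, ‖ρ g₀ - ρ (k i)⁻¹‖ := by
        gcongr
        exact norm_sum_le _ _
    _ ≤ ‖ρ h - ρ g₀‖ * ∑ _i : ι, Real.sqrt (2 * linkCost ρ k g₀) := by
        gcongr with i
        exact hterm i
    _ = Fintype.card ι * ‖ρ h - ρ g₀‖ * Real.sqrt (2 * linkCost ρ k g₀) := by
        rw [Finset.sum_const, Finset.card_univ, nsmul_eq_mul]
        ring

/-- **Consistency at scale `θ/β` ⇒ a quadratic pinch with `O(1/β)` slack at the Gaussian scale.**  If `u_k(g₀) ≤ θ/β` then for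
every `h`, with `r = ‖ρ h − ρ g₀‖`, `m = #ι`, `t = √(2θ)`, `δ = 1/√β`:
`u_k(g₀) + (m/2) r² − m r t δ ≤ u_k(h) ≤ u_k(g₀) + (m/2) r² + m r t δ` and `u_k(g₀) + (m/4) r² − 2 m θ/β ≤ u_k(h)`. [folklore] -/
theorem linkCost_pinch_of_consistent (hU : ∀ g, ρ g ∈ Matrix.unitaryGroup (Fin N) ℂ) {ι : Type*} [Fintype ι]
    (k : ι → G) (g₀ : G) {θ β : ℝ} (hβ : 0 < β) (hθ : 0 ≤ θ) (hcons : linkCost ρ k g₀ ≤ θ / β) (h : G) :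
    linkCost ρ k g₀ + (Fintype.card ι : ℝ) / 2 * ‖ρ h - ρ g₀‖ ^ 2 -
        Fintype.card ι * ‖ρ h - ρ g₀‖ * (Real.sqrt (2 * θ) * (1 / Real.sqrt β)) ≤ linkCost ρ k h ∧
      linkCost ρ k h ≤ linkCost ρ k g₀ + (Fintype.card ι : ℝ) / 2 * ‖ρ h - ρ g₀‖ ^ 2 +
        Fintype.card ι * ‖ρ h - ρ g₀‖ * (Real.sqrt (2 * θ) * (1 / Real.sqrt β)) ∧
      linkCost ρ k g₀ + (Fintype.card ι : ℝ) / 4 * ‖ρ h - ρ g₀‖ ^ 2 - 2 * Fintype.card ι * θ / β ≤ linkCost ρ k h := by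
  have habs := abs_le.1 (abs_linkCost_sub_sub_le ρ hU k g₀ h)
  have hsq : Real.sqrt (2 * linkCost ρ k g₀) ≤ Real.sqrt (2 * θ) * (1 / Real.sqrt β) := by
    rw [mul_one_div, ← Real.sqrt_div (by positivity : (0 : ℝ) ≤ 2 * θ)]
    exact Real.sqrt_le_sqrt (by rw [le_div_iff₀ hβ]; nlinarith [(le_div_iff₀ hβ).1 hcons])
  have hmr : 0 ≤ (Fintype.card ι : ℝ) * ‖ρ h - ρ g₀‖ := by positivity
  have hprod := mul_le_mul_of_nonneg_left hsq hmr
  refine ⟨by linarith, by linarith, ?_⟩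
  -- AM–GM: `m r (t δ) ≤ (m/4) r² + m (t δ)²` and `(t δ)² = 2θ/β`
  have htδ : (Real.sqrt (2 * θ) * (1 / Real.sqrt β)) ^ 2 = 2 * θ / β := by
    rw [mul_pow, Real.sq_sqrt (by positivity : (0 : ℝ) ≤ 2 * θ), one_div, inv_pow, Real.sq_sqrt hβ.le]
    ring
  have hm0 : 0 ≤ (Fintype.card ι : ℝ) := Nat.cast_nonneg _
  have hamgm : (Fintype.card ι : ℝ) * ‖ρ h - ρ g₀‖ * (Real.sqrt (2 * θ) * (1 / Real.sqrt β)) ≤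
      (Fintype.card ι : ℝ) / 4 * ‖ρ h - ρ g₀‖ ^ 2 + Fintype.card ι * (2 * θ / β) := by
    rw [← htδ]
    nlinarith [mul_nonneg hm0 (sq_nonneg (‖ρ h - ρ g₀‖ / 2 - Real.sqrt (2 * θ) * (1 / Real.sqrt β)))]
  have e : (Fintype.card ι : ℝ) * (2 * θ / β) = 2 * Fintype.card ι * θ / β := by ring
  linarith

end Pinch

/-! ## §2 Two abstract integral bounds (two masses; near/far split of a normaliser) -/

section Abstract

variable {α : Type*} [MeasurableSpace α] (μ : Measure α) [IsFiniteMeasure μ]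

/-- **Two masses give a variance.**  If an observable `f` is `≤ L₁` on a region `R₁` and `≥ L₂ ≥ L₁ + 2q` on a region `R₂`, and a
non-negative weight `w` is `≥ w₁` on `R₁` and `≥ w₂` on `R₂`, then for EVERY centre `c`:
`q² · min(w₁ μ(R₁), w₂ μ(R₂)) ≤ ∫ (f − c)² w dμ` — whichever side of the midpoint `c` lies, one region is `≥ q` away from it.
[folklore] -/
theorem sq_mul_min_le_integral_sq_sub_mul {f w : α → ℝ} (c : ℝ) {L₁ L₂ w₁ w₂ q : ℝ} {R₁ R₂ : Set α}
    (hR₁ : MeasurableSet R₁) (hR₂ : MeasurableSet R₂) (hint : Integrable (fun x => (f x - c) ^ 2 * w x) μ)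
    (hw : ∀ x, 0 ≤ w x) (hf₁ : ∀ x ∈ R₁, f x ≤ L₁) (hf₂ : ∀ x ∈ R₂, L₂ ≤ f x) (hq : 0 ≤ q)
    (hgap : L₁ + 2 * q ≤ L₂) (hw₁ : ∀ x ∈ R₁, w₁ ≤ w x) (hw₂ : ∀ x ∈ R₂, w₂ ≤ w x) (hw₁0 : 0 ≤ w₁)
    (hw₂0 : 0 ≤ w₂) :
    q ^ 2 * min (w₁ * μ.real R₁) (w₂ * μ.real R₂) ≤ ∫ x, (f x - c) ^ 2 * w x ∂μ := by
  have key : ∀ {R : Set α} {wR : ℝ}, MeasurableSet R → (∀ x ∈ R, q ^ 2 ≤ (f x - c) ^ 2) →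
      (∀ x ∈ R, wR ≤ w x) → 0 ≤ wR → q ^ 2 * (wR * μ.real R) ≤ ∫ x, (f x - c) ^ 2 * w x ∂μ := by
    intro R wR hR hfR hwR hwR0
    have h1 : ∫ x in R, q ^ 2 * wR ∂μ ≤ ∫ x in R, (f x - c) ^ 2 * w x ∂μ :=
      setIntegral_mono_on (integrableOn_const (measure_ne_top _ _)) hint.integrableOn hR fun x hx =>
        mul_le_mul (hfR x hx) (hwR x hx) hwR0 (sq_nonneg _)
    have h2 : ∫ x in R, (f x - c) ^ 2 * w x ∂μ ≤ ∫ x, (f x - c) ^ 2 * w x ∂μ :=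
      setIntegral_le_integral hint (ae_of_all _ fun x => mul_nonneg (sq_nonneg _) (hw x))
    rw [setIntegral_const, smul_eq_mul] at h1
    calc q ^ 2 * (wR * μ.real R) = μ.real R * (q ^ 2 * wR) := by ring
      _ ≤ _ := h1.trans h2
  by_cases hc : L₁ + q ≤ c
  · have h := key hR₁ (fun x hx => ?_) hw₁ hw₁0
    · exact (mul_le_mul_of_nonneg_left (min_le_left _ _) (sq_nonneg q)).trans h
    · have hx' : q ≤ -(f x - c) := by linarith [hf₁ x hx]
      calc q ^ 2 ≤ (-(f x - c)) ^ 2 := pow_le_pow_left₀ hq hx' 2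
        _ = (f x - c) ^ 2 := neg_sq _
  · have hc' : c < L₁ + q := not_le.1 hc
    have h := key hR₂ (fun x hx => ?_) hw₂ hw₂0
    · exact (mul_le_mul_of_nonneg_left (min_le_right _ _) (sq_nonneg q)).trans h
    · have hx' : q ≤ f x - c := by linarith [hf₂ x hx]
      exact pow_le_pow_left₀ hq hx' 2

/-- **Near/far split of a normaliser.**  If `w ≥ 0` is `≤ B` on `Rn` and `≤ l · u · w` off `Rn` (`u, l ≥ 0`), then
`∫ w dμ ≤ B μ(Rn) + l ∫ u w dμ` (Markov on the far region). [folklore] -/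
theorem integral_le_near_add_far {u w : α → ℝ} {Rn : Set α} (hRn : MeasurableSet Rn) (hwi : Integrable w μ)
    (huw : Integrable (fun x => u x * w x) μ) (hw0 : ∀ x, 0 ≤ w x) (hu0 : ∀ x, 0 ≤ u x) {B l : ℝ} (hl : 0 ≤ l)
    (hnear : ∀ x ∈ Rn, w x ≤ B) (hfar : ∀ x ∈ Rnᶜ, w x ≤ l * (u x * w x)) :
    ∫ x, w x ∂μ ≤ B * μ.real Rn + l * ∫ x, u x * w x ∂μ := by
  rw [← integral_add_compl hRn hwi]
  have h1 : ∫ x in Rn, w x ∂μ ≤ B * μ.real Rn := by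
    calc ∫ x in Rn, w x ∂μ ≤ ∫ _x in Rn, B ∂μ :=
          setIntegral_mono_on hwi.integrableOn (integrableOn_const (measure_ne_top _ _)) hRn hnear
      _ = B * μ.real Rn := by rw [setIntegral_const, smul_eq_mul, mul_comm]
  have h2 : ∫ x in Rnᶜ, w x ∂μ ≤ l * ∫ x, u x * w x ∂μ := by
    calc ∫ x in Rnᶜ, w x ∂μ ≤ ∫ x in Rnᶜ, l * (u x * w x) ∂μ :=
          setIntegral_mono_on hwi.integrableOn (huw.const_mul _).integrableOn hRn.compl hfar
      _ ≤ ∫ x, l * (u x * w x) ∂μ :=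
          setIntegral_le_integral (huw.const_mul _)
            (ae_of_all _ fun x => mul_nonneg hl (mul_nonneg (hu0 x) (hw0 x)))
      _ = l * ∫ x, u x * w x ∂μ := integral_const_mul _ _
  linarith

end Abstract

end Summit.QuantumFields.YangMills.Cruxes.NT.LinkEquipartition

end
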